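import Mathlib
import Summits.NavierStokesRegularity.NavierStokesRegularity.Theses.TypeIQuarterGate
import Summits.NavierStokesRegularity.NavierStokesRegularity.Theorems.TypeILiouvilleLKillsTypeI
import Summits.NavierStokesRegularity.NavierStokesRegularity.Theorems.TypeIQuarterGateTypeIClockLiouvilleFromL
import Summits.NavierStokesRegularity.NavierStokesRegularity.Theorems.TypeIQuarterGateQuarterZoom
import HarnessLib

/-!
# `TypeIQuarterGate`: the whole ATTACKED side of the route lies below the KNSS Liouville conjecture (L)
# — by-name edges from item `TypeILiouville.TypeIliouvilleL` (stmt-NavierStokesRegularity-10661)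

Helper file (`--supports stmt-NavierStokesRegularity-23726`; theorems only, no definitions) for the
crux `QuarterLawTypeI` (K1, stmt-23726) and its companions `LorentzUpgradeTypeI` (LU, stmt-24108 = the
one open registered stub `stub_lorentzUpgrade` of the line `lorentz-upgrade`),
`UniformConcentrationCountTypeI` (UCC, stmt-23970), `FiniteScarsTypeI` (FS, stmt-23842) and
`ScarEnvelopeTypeI` (SE, stmt-23843).

Every one of these five statements quantifies over maximal classical Leray–Hopf solutions from a
rapidly decaying datum WITH THE SUP-NORM TYPE-I RATE at the lifespan `T`
(`IsMaximalSmoothSolution ∧ IsLerayHopfOn ∧ HasRapidSpatialDecay ∧ IsTypeIBlowup`).  The CLOSED item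
`TypeILiouville.TypeIliouvilleLKillsTypeI` (stmt-10662,
`typeILiouville_typeIliouvilleLKillsTypeI_proof`: KNSS zoom + Albritton–Barker forward zoom, all
proved in the tree) says that under (L) this class of solutions is EMPTY.  Hence, by name:

* `quarterLawTypeI_of_typeIliouvilleL`, `lorentzUpgradeTypeI_of_typeIliouvilleL`,
  `uniformConcentrationCountTypeI_of_typeIliouvilleL`, `finiteScarsTypeI_of_typeIliouvilleL`,
  `scarEnvelopeTypeI_of_typeIliouvilleL` — (L) ⟹ K1, LU, UCC, FS, SE;
* `stubLorentzUpgrade_signature_of_typeIliouvilleL` — the registered signature of the open stub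
  `stub_lorentzUpgrade` (skeleton `a3194bad1bab`) holds under (L);
* `typeIQuarterGate_attackedSide_of_typeIliouvilleL` — (L) ⟹ K1 ∧ X2 (both non-residual conjuncts of
  the route's thesis `X = QuarterLawTypeI ∧ ParabolicGaldiLiouville ∧ NoTypeII`; X2 ⟸ (L) is the tree's
  `ParabolicGaldiLiouville.Birth.parabolicGaldiLiouville_of_liouvilleConjectureNS`);
* `typeIQuarterGate_thesis_of_noTypeII_of_typeIliouvilleL` and
  `navierStokesRegularity_of_noTypeII_of_typeIliouvilleL_viaTypeIQuarterGate` — so with (L) as back end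
  (cf. `typeIQuarterGate_of_typeIliouvilleL`, which still carried K1 as a hypothesis) K1 is IDLE: the
  route's own deciding theorem `Theses.TypeIQuarterGate.closes` fires from `NoTypeII ∧ (L)` alone.

READING FOR THE PLANNER (repair census of the 5th leafhand generation): K1 ⟺ LU ⟺ UCC (p818591) is an
open problem lying STRICTLY INSIDE the cone of (L) — a genuine intermediate (Type-I exclusion would
settle it vacuously; it asks for less: Leray's quarter rate along a Type-I blow-up, not its
non-existence) — and any assembly of this route that keeps a Liouville-type back end at least as
strong as (L) does not use K1 at all.  HONEST FRAMING: implications between OPEN statements; (L), K1,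
LU, UCC, FS, SE all remain open; nothing here bears on Navier–Stokes regularity itself.
References: Koch–Nadirashvili–Seregin–Šverák, Acta Math. 203 (2009) §1, §6; Seregin–Šverák 2009 §1.
-/

-- the problem directory repeats the summit name (D-0017); core's `dupNamespace` linter fires
set_option linter.dupNamespace false

noncomputable section

namespace Summit.NavierStokesRegularity.NavierStokesRegularity.Theorems

namespace CruxesBelowLiouvilleL

open Set MeasureTheory
open Literature.Analysis.FluidPDE
open Summit.NavierStokesRegularity.NavierStokesRegularity.Theses

/-- **Under (L) the Type-I Clay class is empty**: assuming item `TypeILiouville.TypeIliouvilleL`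
(stmt-10661), no maximal classical solution which is Leray–Hopf from a rapidly decaying datum has the
sup-norm Type-I rate at its lifespan — the closed item `TypeILiouville.TypeIliouvilleLKillsTypeI`
(stmt-10662) applied to (L). [cite: KochNadirashviliSereginSverak2009, §1 conjecture (L) and §6 Prop. 6.1] -/
theorem not_isTypeIBlowup_of_typeIliouvilleL (hL : TypeILiouville.TypeIliouvilleL)
    {ν T : ℝ} (hν : 0 < ν) (hT : 0 < T)
    {u : ℝ → EuclideanSpace ℝ (Fin 3) → EuclideanSpace ℝ (Fin 3)}
    {p : ℝ → EuclideanSpace ℝ (Fin 3) → ℝ}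
    (hmax : IsMaximalSmoothSolution ν 0 u p T) (hLH : IsLerayHopfOn T ν 0 (u 0) u)
    (hdec : HasRapidSpatialDecay (u 0)) : ¬ IsTypeIBlowup u T :=
  typeILiouville_typeIliouvilleLKillsTypeI_proof hL ν T hν hT u p hmax hLH hdec

/-- **(L) ⟹ K1.** Item `TypeILiouville.TypeIliouvilleL` (stmt-10661) implies the crux
`TypeIQuarterGate.QuarterLawTypeI` (stmt-23726) — vacuously: under (L) there is no Type-I blow-up in the
Clay class (`not_isTypeIBlowup_of_typeIliouvilleL`). [cite: KochNadirashviliSereginSverak2009, §1 and §6] -/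
theorem quarterLawTypeI_of_typeIliouvilleL (hL : TypeILiouville.TypeIliouvilleL) :
    TypeIQuarterGate.QuarterLawTypeI := by
  intro ν T hν hT u p hmax hLH hdec hI
  exact absurd hI (not_isTypeIBlowup_of_typeIliouvilleL hL hν hT hmax hLH hdec)

/-- **The registered signature of `stub_lorentzUpgrade` holds under (L)** (skeleton `a3194bad1bab` of
the line `lorentz-upgrade` on stmt-23726; the signature — the definiens of `LorentzUpgradeTypeI` — is
spelled out verbatim): vacuous, the Type-I Clay class being empty under (L). [cite: KochNadirashviliSereginSverak2009, §1 and §6] -/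
theorem stubLorentzUpgrade_signature_of_typeIliouvilleL (hL : TypeILiouville.TypeIliouvilleL) :
    ∀ (ν T : ℝ), 0 < ν → 0 < T →
      ∀ (u : ℝ → EuclideanSpace ℝ (Fin 3) → EuclideanSpace ℝ (Fin 3))
        (p : ℝ → EuclideanSpace ℝ (Fin 3) → ℝ),
      Literature.Analysis.FluidPDE.IsMaximalSmoothSolution ν 0 u p T →
      Literature.Analysis.FluidPDE.IsLerayHopfOn T ν 0 (u 0) u →
      Literature.Analysis.FluidPDE.HasRapidSpatialDecay (u 0) →
      Literature.Analysis.FluidPDE.IsTypeIBlowup u T →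
      (∃ M' : ℝ, ∀ t ∈ Set.Ico 0 T,
        Literature.Analysis.FunctionSpaces.eWeakLpPow (u t) 3 MeasureTheory.volume ≤
          ENNReal.ofReal M') := by
  intro ν T hν hT u p hmax hLH hdec hI
  exact absurd hI (not_isTypeIBlowup_of_typeIliouvilleL hL hν hT hmax hLH hdec)

/-- **(L) ⟹ LU.** Item `TypeILiouville.TypeIliouvilleL` (stmt-10661) implies the crux
`TypeIQuarterGate.LorentzUpgradeTypeI` (stmt-24108 = the open registered stub `stub_lorentzUpgrade` of
the line `lorentz-upgrade` on stmt-23726, whose signature is its definiens) — vacuously. [cite: KochNadirashviliSereginSverak2009, §1 and §6] -/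
theorem lorentzUpgradeTypeI_of_typeIliouvilleL (hL : TypeILiouville.TypeIliouvilleL) :
    TypeIQuarterGate.LorentzUpgradeTypeI :=
  stubLorentzUpgrade_signature_of_typeIliouvilleL hL

/-- **(L) ⟹ UCC.** Item `TypeILiouville.TypeIliouvilleL` (stmt-10661) implies the crux
`TypeIQuarterGate.UniformConcentrationCountTypeI` (stmt-23970) — vacuously. [cite: KochNadirashviliSereginSverak2009, §1 and §6] -/
theorem uniformConcentrationCountTypeI_of_typeIliouvilleL (hL : TypeILiouville.TypeIliouvilleL) :
    TypeIQuarterGate.UniformConcentrationCountTypeI := by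
  intro ν T hν hT u p hmax hLH hdec hI
  exact absurd hI (not_isTypeIBlowup_of_typeIliouvilleL hL hν hT hmax hLH hdec)

/-- **(L) ⟹ FS.** Item `TypeILiouville.TypeIliouvilleL` (stmt-10661) implies the crux
`TypeIQuarterGate.FiniteScarsTypeI` (stmt-23842) — vacuously. [cite: KochNadirashviliSereginSverak2009, §1 and §6] -/
theorem finiteScarsTypeI_of_typeIliouvilleL (hL : TypeILiouville.TypeIliouvilleL) :
    TypeIQuarterGate.FiniteScarsTypeI := by
  intro ν T hν hT u p hmax hLH hdec hI
  exact absurd hI (not_isTypeIBlowup_of_typeIliouvilleL hL hν hT hmax hLH hdec)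

/-- **(L) ⟹ SE.** Item `TypeILiouville.TypeIliouvilleL` (stmt-10661) implies the crux
`TypeIQuarterGate.ScarEnvelopeTypeI` (stmt-23843, open registered stub `stub_dustKill` of the line
`slice_budget`) — vacuously. [cite: KochNadirashviliSereginSverak2009, §1 and §6] -/
theorem scarEnvelopeTypeI_of_typeIliouvilleL (hL : TypeILiouville.TypeIliouvilleL) :
    TypeIQuarterGate.ScarEnvelopeTypeI := by
  intro ν T hν hT u p hmax hLH hdec hI
  exact absurd hI (not_isTypeIBlowup_of_typeIliouvilleL hL hν hT hmax hLH hdec)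

/-- **(L) ⟹ X2 in this route's spelling.** Item `TypeILiouville.TypeIliouvilleL` (stmt-10661) implies
`TypeIQuarterGate.ParabolicGaldiLiouville` (= stmt-0893 verbatim): the tree's
`ParabolicGaldiLiouville.Birth.parabolicGaldiLiouville_of_liouvilleConjectureNS` (an a.e.-constant `L⁶`
slice of a smooth field vanishes). [cite: KochNadirashviliSereginSverak2009, §1] -/
theorem parabolicGaldiLiouville_of_typeIliouvilleL (hL : TypeILiouville.TypeIliouvilleL) :
    TypeIQuarterGate.ParabolicGaldiLiouville := by
  have hLC : Summit.NavierStokesRegularity.NavierStokesRegularity.LiouvilleConjectureNS := hL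
  exact ParabolicGaldiLiouville.Birth.parabolicGaldiLiouville_of_liouvilleConjectureNS hLC

/-- **(L) discharges the whole attacked side of the route**: item `TypeILiouville.TypeIliouvilleL`
(stmt-10661) implies `QuarterLawTypeI ∧ ParabolicGaldiLiouville` — both non-residual conjuncts of the
thesis `X = QuarterLawTypeI ∧ ParabolicGaldiLiouville ∧ NoTypeII` of `TypeIQuarterGate`. [cite: KochNadirashviliSereginSverak2009, §1 and §6] -/
theorem typeIQuarterGate_attackedSide_of_typeIliouvilleL (hL : TypeILiouville.TypeIliouvilleL) :
    TypeIQuarterGate.QuarterLawTypeI ∧ TypeIQuarterGate.ParabolicGaldiLiouville :=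
  ⟨quarterLawTypeI_of_typeIliouvilleL hL, parabolicGaldiLiouville_of_typeIliouvilleL hL⟩

/-- **The route's thesis from `NoTypeII ∧ (L)`.** `X = QuarterLawTypeI ∧ ParabolicGaldiLiouville ∧
NoTypeII` follows from the residual `NoTypeII` (stmt-0056) and item `TypeILiouville.TypeIliouvilleL`
(stmt-10661) alone. [cite: KochNadirashviliSereginSverak2009, §1 and §6] -/
theorem typeIQuarterGate_thesis_of_noTypeII_of_typeIliouvilleL (hII : TypeIQuarterGate.NoTypeII)
    (hL : TypeILiouville.TypeIliouvilleL) :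
    TypeIQuarterGate.QuarterLawTypeI ∧ TypeIQuarterGate.ParabolicGaldiLiouville ∧
      TypeIQuarterGate.NoTypeII :=
  let h := typeIQuarterGate_attackedSide_of_typeIliouvilleL hL
  ⟨h.1, h.2, hII⟩

/-- **K1 is idle once (L) is the back end.** The route's own deciding theorem
`Theses.TypeIQuarterGate.closes` fires from `NoTypeII ∧ (L)`: its inputs `QuarterLawTypeI` and
`ParabolicGaldiLiouville` come from (L) (this file) and `QuarterZoom` is proved
(`typeIQuarterGate_quarterZoom_proof`).  Compare `typeIQuarterGate_of_typeIliouvilleL`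
(`QuarterLawTypeI → NoTypeII → (L) → NavierStokesRegularity`), whose first hypothesis is hereby
discharged by its third. [cite: KochNadirashviliSereginSverak2009, §1 and §6] -/
theorem navierStokesRegularity_of_noTypeII_of_typeIliouvilleL_viaTypeIQuarterGate
    (hII : TypeIQuarterGate.NoTypeII) (hL : TypeILiouville.TypeIliouvilleL) :
    NavierStokesRegularity := by
  obtain ⟨hQ, hP, hII'⟩ := typeIQuarterGate_thesis_of_noTypeII_of_typeIliouvilleL hII hL
  exact TypeIQuarterGate.closes hQ typeIQuarterGate_quarterZoom_proof hP hII'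

/-- The same conclusion through the lineage's by-name assembly `typeIQuarterGate_of_typeIliouvilleL`
(K1 → NoTypeII → (L) → ROOT), with K1 now supplied by (L) itself. [cite: KochNadirashviliSereginSverak2009, §1 and §6] -/
theorem typeIQuarterGate_of_typeIliouvilleL' (hII : TypeIQuarterGate.NoTypeII)
    (hL : TypeILiouville.TypeIliouvilleL) : NavierStokesRegularity :=
  typeIQuarterGate_of_typeIliouvilleL (quarterLawTypeI_of_typeIliouvilleL hL) hII hL

end CruxesBelowLiouvilleL

end Summit.NavierStokesRegularity.NavierStokesRegularity.Theorems

end
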